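import Summits.NavierStokesRegularity.NavierStokesRegularity.Theses.AxisymmetricExtremality
import Summits.NavierStokesRegularity.NavierStokesRegularity.Theorems.AxisymmetricExtremalityMinimalDatumPFoldThresholdFinite

/-!
# Strategy split (D1) for crux `MinimalDatumPFold` (stmt-NavierStokesRegularity-15452) — glue PROVED (rc 0, 0 sorry)

Crux-strategist workfile (planner-cstrat-stmt-NavierStokesRegularity-15452-b1-0, 2026-08-17): the typed split
`MinimalDatumPFold ⇐ SymmGapClosing ∧ SymmThresholdAttained` of `STRATEGY-CENSUS.md` § Decomposition, children
WRITTEN OUT (no `def`), so that a prover / tenure / final-cycle seat can land this file verbatim as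
`Theorems/AxisymmetricExtremalityMinimalDatumPFoldSplit.lean` (`--supports stmt-NavierStokesRegularity-15452`) and run
`ledger route edit route-NavierStokesRegularity-AxisymmetricExtremality --split MinimalDatumPFold --into children-D1.json
 --glue-by Summit.NavierStokesRegularity.NavierStokesRegularity.Theorems.minimalDatumPFold_of_subs` (children-D1.json =
evidence on the item; statements byte-identical to the two hypotheses below). Theorems/ is prover-only and `--split`
is final-cycle-only for a strategist seat (ABC precedent, bounced twice), so nothing is filed from here.

* child 1 `SymmGapClosing` (crux, OPEN; = `stub_symmGapClosing` of line `symmetric-gap`): Clay failure at ν ⇒ ∀N ∃p ≥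
  max(N,2) ∀ε>0 an a.e.-`R_{2π/p}`-equivariant blow-up datum of norm `< ρ_max^pure ν + ε` (ρ_p = ρ_max, infimum form).
* child 2 `SymmThresholdAttained` (support, provable now, M–L; = stubs `stub_nearMinimalLimit` +
  `stub_symmetryDefectInLimit` of line `symmetric-gap` + landed `stub_minimalDatum_not_aeZero`, `stub_liftRecentre` +
  shared `stub_liftAeToExact`): for ν>0, ρ_max^pure ν < ⊤, p ≥ 2, such an ε-family ⇒ an exactly equivariant MINIMAL
  blow-up datum.
* glue `minimalDatumPFold_of_subs : child₁ → child₂ → MinimalDatumPFold` (uses the LANDED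
  `stub_thresholdFinite_of_clayFailure`, p147201, for `ρ_max^pure ν < ⊤`), and the easy converse
  `symmGapClosing_of_minimalDatumPFold : MinimalDatumPFold → child₁` (child 1 is a consequence of the crux, used toward it).
-/

set_option linter.dupNamespace false

namespace Summit.NavierStokesRegularity.NavierStokesRegularity.Cruxes.MinimalDatumPFold.StrategySplit

/-- **Glue of the split (D1), proved.** `SymmGapClosing → SymmThresholdAttained → MinimalDatumPFold`, children written
out; shape `C₁ → C₂ → C` for `ledger route edit --split MinimalDatumPFold --glue-by`. [folklore] -/
theorem minimalDatumPFold_of_subs :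
    (∀ ν : ℝ, 0 < ν → (∃ v₀ : EuclideanSpace ℝ (Fin 3) → EuclideanSpace ℝ (Fin 3), ContDiff ℝ (⊤ : ℕ∞) v₀ ∧ Literature.Analysis.FluidPDE.NSWave0.IsDivFree v₀ ∧ Literature.Analysis.FluidPDE.HasRapidSpatialDecay v₀ ∧ ¬ ∃ (u : ℝ → EuclideanSpace ℝ (Fin 3) → EuclideanSpace ℝ (Fin 3)) (p : ℝ → EuclideanSpace ℝ (Fin 3) → ℝ), Literature.Analysis.FluidPDE.IsSmoothOnHalfSpace u ∧ Literature.Analysis.FluidPDE.IsSmoothOnHalfSpace p ∧ Literature.Analysis.FluidPDE.IsNavierStokesSolution ν 0 v₀ u p ∧ Literature.Analysis.FluidPDE.HasBoundedEnergy u) → ∀ N : ℕ, ∃ p : ℕ, N ≤ p ∧ 2 ≤ p ∧ ∀ ε : ENNReal, 0 < ε → ∃ (u₀ : EuclideanSpace ℝ (Fin 3) → EuclideanSpace ℝ (Fin 3)) (g : Literature.Analysis.FunctionSpaces.HomSobolev (EuclideanSpace ℝ (Fin 3)) (EuclideanSpace ℂ (Fin 3)) (1 / 2 : ℝ)), MeasureTheory.MemLp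 u₀ 3 (MeasureTheory.volume : MeasureTheory.Measure (EuclideanSpace ℝ (Fin 3))) ∧ g.Represents (Literature.Analysis.FunctionSpaces.EuclideanSpace.complexify ∘ u₀) ∧ Literature.Analysis.FluidPDE.IsWeaklyDivFree u₀ ∧ ¬ Literature.Analysis.FluidPDE.HasGlobalKatoSolution ν u₀ ∧ ‖g‖ₑ < Literature.Analysis.FluidPDE.rusinSverakRhoMaxPure ν + ε ∧ ∀ᵐ x ∂(MeasureTheory.volume : MeasureTheory.Measure (EuclideanSpace ℝ (Fin 3))), u₀ (WithLp.toLp 2 ![Real.cos (2 * Real.pi / p) * x 0 - Real.sin (2 * Real.pi / p) * x 1, Real.sin (2 * Real.pi / p) * x 0 + Real.cos (2 * Real.pi / p) * x 1, x 2]) = WithLp.toLp 2 ![Real.cos (2 * Real.pi / p) * u₀ x 0 - Real.sin (2 * Real.pi / p) * u₀ x 1, Real.sin (2 * Real.pi / p) * u₀ x 0 + Real.cos (2 * Real.pi / p) * u₀ x 1, u₀ x 2]) →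
    (∀ ν : ℝ, 0 < ν → Literature.Analysis.FluidPDE.rusinSverakRhoMaxPure ν < ⊤ → ∀ p : ℕ, 2 ≤ p → (∀ ε : ENNReal, 0 < ε → ∃ (u₀ : EuclideanSpace ℝ (Fin 3) → EuclideanSpace ℝ (Fin 3)) (g : Literature.Analysis.FunctionSpaces.HomSobolev (EuclideanSpace ℝ (Fin 3)) (EuclideanSpace ℂ (Fin 3)) (1 / 2 : ℝ)), MeasureTheory.MemLp u₀ 3 (MeasureTheory.volume : MeasureTheory.Measure (EuclideanSpace ℝ (Fin 3))) ∧ g.Represents (Literature.Analysis.FunctionSpaces.EuclideanSpace.complexify ∘ u₀) ∧ Literature.Analysis.FluidPDE.IsWeaklyDivFree u₀ ∧ ¬ Literature.Analysis.FluidPDE.HasGlobalKatoSolution ν u₀ ∧ ‖g‖ₑ < Literature.Analysis.FluidPDE.rusinSverakRhoMaxPure ν + ε ∧ ∀ᵐ x ∂(MeasureTheory.volume : MeasureTheory.Measure (EuclideanSpace ℝ (Fin 3))), u₀ (WithLp.toLp 2 ![Real.cos (2 * Real.pi / p) * x 0 - Real.sin (2 * Real.pi / p) * x 1, Real.sin (2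 * Real.pi / p) * x 0 + Real.cos (2 * Real.pi / p) * x 1, x 2]) = WithLp.toLp 2 ![Real.cos (2 * Real.pi / p) * u₀ x 0 - Real.sin (2 * Real.pi / p) * u₀ x 1, Real.sin (2 * Real.pi / p) * u₀ x 0 + Real.cos (2 * Real.pi / p) * u₀ x 1, u₀ x 2]) → ∃ (u₀ : EuclideanSpace ℝ (Fin 3) → EuclideanSpace ℝ (Fin 3)) (g : Literature.Analysis.FunctionSpaces.HomSobolev (EuclideanSpace ℝ (Fin 3)) (EuclideanSpace ℂ (Fin 3)) (1 / 2 : ℝ)), Literature.Analysis.FluidPDE.IsMinimalBlowupDatum ν u₀ g ∧ ∀ x : EuclideanSpace ℝ (Fin 3), u₀ (WithLp.toLp 2 ![Real.cos (2 * Real.pi / p) * x 0 - Real.sin (2 * Real.pi / p) * x 1, Real.sin (2 * Real.pi / p) * x 0 + Real.cos (2 * Real.pi / p) * x 1, x 2]) = WithLp.toLp 2 ![Real.cos (2 * Real.pi / p) * u₀ x 0 - Real.sin (2 * Real.pi / p) * u₀ x 1, Real.sin (2 * Real.pi / p) * u₀ x 0 + Real.cos (2 * Real.pi / p) * u₀ x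 1, u₀ x 2]) →
      Summit.NavierStokesRegularity.NavierStokesRegularity.Theses.AxisymmetricExtremality.MinimalDatumPFold := by
  intro hA hB ν hν hclay N
  have hfin : Literature.Analysis.FluidPDE.rusinSverakRhoMaxPure ν < ⊤ :=
    Summit.NavierStokesRegularity.NavierStokesRegularity.Theorems.stub_thresholdFinite_of_clayFailure ν hν hclay
  obtain ⟨p, hNp, h2p, hfam⟩ := hA ν hν hclay N
  obtain ⟨u₀, g, hmin, hsym⟩ := hB ν hν hfin p h2p hfam
  exact ⟨p, hNp, h2p, u₀, g, hmin, hsym⟩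

/-- **Exactness, easy direction**: the crux gives child 1 outright (a minimal datum has norm
`ρ_max^pure ν < ρ_max^pure ν + ε` since the threshold is finite under Clay failure, and pointwise ⇒ a.e.). [folklore] -/
theorem symmGapClosing_of_minimalDatumPFold
    (h : Summit.NavierStokesRegularity.NavierStokesRegularity.Theses.AxisymmetricExtremality.MinimalDatumPFold) :
    ∀ ν : ℝ, 0 < ν → (∃ v₀ : EuclideanSpace ℝ (Fin 3) → EuclideanSpace ℝ (Fin 3), ContDiff ℝ (⊤ : ℕ∞) v₀ ∧ Literature.Analysis.FluidPDE.NSWave0.IsDivFree v₀ ∧ Literature.Analysis.FluidPDE.HasRapidSpatialDecay v₀ ∧ ¬ ∃ (u : ℝ → EuclideanSpace ℝ (Fin 3) → EuclideanSpace ℝ (Fin 3)) (p : ℝ → EuclideanSpace ℝ (Fin 3) → ℝ), Literature.Analysis.FluidPDE.IsSmoothOnHalfSpace u ∧ Literature.Analysis.FluidPDE.IsSmoothOnHalfSpace p ∧ Literature.Analysis.FluidPDE.IsNavierStokesSolution ν 0 v₀ u p ∧ Literature.Analysis.FluidPDE.HasBoundedEnergy u) → ∀ N : ℕ, ∃ p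 : ℕ, N ≤ p ∧ 2 ≤ p ∧ ∀ ε : ENNReal, 0 < ε → ∃ (u₀ : EuclideanSpace ℝ (Fin 3) → EuclideanSpace ℝ (Fin 3)) (g : Literature.Analysis.FunctionSpaces.HomSobolev (EuclideanSpace ℝ (Fin 3)) (EuclideanSpace ℂ (Fin 3)) (1 / 2 : ℝ)), MeasureTheory.MemLp u₀ 3 (MeasureTheory.volume : MeasureTheory.Measure (EuclideanSpace ℝ (Fin 3))) ∧ g.Represents (Literature.Analysis.FunctionSpaces.EuclideanSpace.complexify ∘ u₀) ∧ Literature.Analysis.FluidPDE.IsWeaklyDivFree u₀ ∧ ¬ Literature.Analysis.FluidPDE.HasGlobalKatoSolution ν u₀ ∧ ‖g‖ₑ < Literature.Analysis.FluidPDE.rusinSverakRhoMaxPure ν + ε ∧ ∀ᵐ x ∂(MeasureTheory.volume : MeasureTheory.Measure (EuclideanSpace ℝ (Fin 3))), u₀ (WithLp.toLp 2 ![Real.cos (2 * Real.pi / p) * x 0 - Real.sin (2 * Real.pi / p) * x 1, Real.sin (2 * Real.pi / p) * x 0 + Real.cos (2 * Real.pi / p) * x 1, x 2]) = WithLp.toLp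 2 ![Real.cos (2 * Real.pi / p) * u₀ x 0 - Real.sin (2 * Real.pi / p) * u₀ x 1, Real.sin (2 * Real.pi / p) * u₀ x 0 + Real.cos (2 * Real.pi / p) * u₀ x 1, u₀ x 2] := by
  intro ν hν hclay N
  have hfin : Literature.Analysis.FluidPDE.rusinSverakRhoMaxPure ν < ⊤ :=
    Summit.NavierStokesRegularity.NavierStokesRegularity.Theorems.stub_thresholdFinite_of_clayFailure ν hν hclay
  obtain ⟨p, hNp, h2p, u₀, g, hmin, hsym⟩ := h ν hν hclay N
  refine ⟨p, hNp, h2p, fun ε hε => ⟨u₀, g, hmin.1, hmin.2.1, hmin.2.2.1, hmin.2.2.2.2, ?_, ?_⟩⟩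
  · rw [hmin.2.2.2.1]
    exact ENNReal.lt_add_right hfin.ne hε.ne'
  · exact Filter.Eventually.of_forall hsym

end Summit.NavierStokesRegularity.NavierStokesRegularity.Cruxes.MinimalDatumPFold.StrategySplit
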